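import Literature.MathematicalPhysics.QuantumFieldTheory.Balaban1983to89.T3AlphaInputsAC
import HarnessLib

/-!
# S1a · UV3-NODE §69.2 row δ2 ∕ §69.8 (3) — THE (α)-SOCKET's BACKGROUND IS A `Setup.IsBackground` OVER PRINT's TWO-CLAUSE REGULAR CLASS `RegPr`:
# the `isBackground` ∕ `reg_regular` ∕ `one_mem_reg` FIELDS of the (m2) door's `BalabanUVClass.Witness` (v1.2, δ2-a) discharged BY NAME from
# `UminTrivIsRegMinimiser`, today (the statement is `Setup.IsBackground`, whose competitor class is already a parameter)

Cell `ym3-torus` (YM ladder rung R3 = continuum `SU(2)` Yang–Mills on the three-torus — a RUNG: NOT d = 4, NOT infinite volume, NOT a mass gap, NOT Clay).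
Width seat «width 8» `ym3-torus-px8` (gen 23), FREE px helper on crux `stmt-QuantumFields-20520`, count-neutral, DEFINITION-FREE, default heartbeats; the δ2 row of
the (m2) door «(α)-socket ⟹ `BalabanUVClass.Witness`» (UV3-NODE §69.2, px20 g20 09:06:17Z «GO — YOURS» to the px8 lineage; ★★OWNER RULING ym3-torus-plan №82 (1):
«with the class a parameter the (α)∕(m2) door sets `reg :=` print's space read on run K and discharges `isBackground` from PRINTED inputs (`UminTrivIsRegMinimiser` +
`Constraint42Top` + REG-ARGMIN̄∘'s `RegPr ⊆ PlaqSmall` clause) — no unprinted equality anywhere»).  This file IS that discharge, in the currency every edition of the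
class file can take: `Setup.IsBackground av reg k V U₀` («`avg^k U₀ = V ∧ U₀ ∈ reg ∧ ∀ U ∈ reg, avg^k U = V → A(U₀) ≤ A(U)`», [Balaban1985Variational] Thm 1 p.279 as
typed in `Setup` §12) with `reg := {U | RegPr F n K ε₀ U}` = print's `𝔘_k(ε₀)` in full ([Balaban1985Variational] (2) p.278, BOTH clauses; tree
`T3PrintedRegularMinimiser.RegPr`).

WHAT (run `K`, comparison height `n ≤ K`, level `k = K − n`, averaging of record `ℰp`, datum `W : GaugeField (F.P K) (K − n) SU(2)`):
* §1 bookkeeping across the level identification: `descendTo_eq_iff_iter_eq` (membership in the descent fibre of `V` ⟺ the `(K − n)`-fold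
  `ℰp`-average IS `V` read on run `K`'s level `K − n`), `mem_fibre_iff_iter_eq`.
* §2 ★★ `isBackground_regPr_of_uminTriv` — from `UminTrivIsRegMinimiser D b₀ p₀ ε₀` ALONE: for every `θBal(n)`-small level-`(K − n)` datum `W` of run `K`,
  `IsBackground (blockAvg ℰp) {U | RegPr F n K ε₀ U} (K − n) W (D.Umin K (K − n) (D.triv K (K − n)) W)` — the trivial-history composite minimiser averages back to
  `W`, lies in print's regular space, and minimises the Wilson action among the printed-regular fine configurations averaging to `W` (`minActionRegPr_le`).
  (`Constraint42Top` is NOT needed: the fibre clause is inside `regFibrePr`.)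
* §3 the two companion fields of the δ2-a `Witness` for this class: `regPr_subset_plaqSmall` (`{RegPr} ⊆ {PlaqSmall δreg}` whenever `regThreshold F n K ε₀ ≤ δreg` —
  the ONE schedule line the typer must grant, named here; `reg_regular`) and `one_mem_regPr` (`0 < ε₀ → 1 ∈ {RegPr}`; `one_mem_reg`'s content, from ✓`regPr_one`).
* §4 ★★ `isBackground_regPr_window` — the same packaged in the (m2) door's binder shape `∀ W, PlaqSmall δ W → IsBackground … W (bg W)` for any window `δ ≤ θBal(n)`,
  `bg := fun W => D.Umin K (K − n) (D.triv K (K − n)) W` — character-for-character the `isBackground` field of a `Witness (k := K − n) (blockAvg ℰp) prm _` with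
  `reg := {U | RegPr F n K ε₀ U}` once δ2-a lands (HOME `ym3-torus-px8/g23/delta2a/`); before that it is the honest statement the pinned field cannot take (§69.7 (2)).

WHAT THIS FILE IS NOT: no `Witness` is built (the other fields are §69.2's other rows); the one-clause pinned class of `BalabanUVClass` v1.0–v1.1 is NOT served (that would
need the UNPRINTED G-K1a-1 equality, RULING №82 (2)); `UminTrivIsRegMinimiser` is a HYPOTHESIS schema on a GIVEN `D` ([Balaban1985Variational] Thm 1 (8) p.279 is its
source, not asserted here); nothing of Bałaban's is proved; S1a(ᴴ), crux 20520 and `YM3TorusSU2` are NOT proved; no registered stub is closed; the Yang–Mills mass gap is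
NOT proved.  Sorry-free, axioms standard.

References: T. Bałaban, CMP **102** (1985) 277–309 [Balaban1985Variational] ((2), (6) p.278, Thm 1 (8) p.279); CMP **102** (1985) 255–275 [Balaban1985UV3] ((42) p.266).
-/

set_option autoImplicit false

noncomputable section

namespace Summit.QuantumFields.YangMills.Theorems.FluctuationComparisonRegPrIntLS1aAlphaBackgroundClass

open MeasureTheory
open Literature.MathematicalPhysics.QuantumFieldTheory.Balaban1983to89
open T3ContinuumYM3Torus T3LevelShift T3UnitScaleTilt T3UnitLawDensityEML T3TiltDescent T3ConstrainedMinimiser T3DescentFibreTower T3RegularMinimiser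
  T3PrintedRegularMinimiser T3AlphaInputsAC

variable {F : T3Family} {γ : ℝ}

/-! ## §1 Bookkeeping across the level identification `fieldShift` -/

/-- **THE DESCENT FIBRE IN RUN-`K` CURRENCY**: `D_{n,K} U = V` iff the `(K − n)`-fold `ℰp`-average of `U` is `V` read on run `K`'s level `K − n` (`descendTo` is that average
followed by the level identification, which is invertible). [cite: Balaban1987RG1, (0.11) p.253] -/
theorem descendTo_eq_iff_iter_eq {n K : ℕ} (h : n ≤ K) (U : GaugeField (F.P K) 0 (Matrix.specialUnitaryGroup (Fin 2) ℂ))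
    (V : GaugeField (F.P n) 0 (Matrix.specialUnitaryGroup (Fin 2) ℂ)) :
    descendTo F ℰp n K h U = V ↔
      Averaging.iter (fun i => BlockAveraging.blockAvg (P := F.P K) (j := i) ℰp) (K - n) U =
        fieldShift (F.sitesPerDir_eq (m := F.m) (K := K) (j := K - n) (m' := F.m) (K' := n) (j' := 0) (by omega)) V := by
  unfold descendTo
  constructor
  · intro hU
    have := congrArg (fieldShift (F.sitesPerDir_eq (m := F.m) (K := K) (j := K - n) (m' := F.m) (K' := n) (j' := 0) (by omega))) hU
    rwa [fieldShift_fieldShift, fieldShift_refl] at this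
  · intro hU
    rw [hU, fieldShift_fieldShift, fieldShift_refl]

/-- Membership in the descent fibre of `V`, in run-`K` currency. [cite: Balaban1987RG1, (0.11) p.253] -/
theorem mem_fibre_iff_iter_eq {n K : ℕ} (h : n ≤ K) (U : GaugeField (F.P K) 0 (Matrix.specialUnitaryGroup (Fin 2) ℂ))
    (V : GaugeField (F.P n) 0 (Matrix.specialUnitaryGroup (Fin 2) ℂ)) :
    U ∈ fibre F ℰp n K h V ↔
      Averaging.iter (fun i => BlockAveraging.blockAvg (P := F.P K) (j := i) ℰp) (K - n) U =
        fieldShift (F.sitesPerDir_eq (m := F.m) (K := K) (j := K - n) (m' := F.m) (K' := n) (j' := 0) (by omega)) V :=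
  (mem_fibre_iff F ℰp).trans (descendTo_eq_iff_iter_eq h U V)

/-! ## §2 The background over print's regular class, from `UminTrivIsRegMinimiser` -/

/-- ★★ **THE TRIVIAL-HISTORY COMPOSITE MINIMISER IS A `Setup.IsBackground` OVER PRINT's REGULAR SPACE `𝔘_k(ε₀)`**: under `UminTrivIsRegMinimiser D b₀ p₀ ε₀`, for every
`θBal(n)`-small datum `V` of the comparison lattice read on run `K`'s level `K − n`, `U_{K−n}(V)` averages back to the datum, is printed-regular, and has Wilson action
`≤` that of every printed-regular fine configuration with the same average ([Balaban1985Variational] Thm 1 (8) p.279 «there exists exactly one minimal orbit … in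
𝔘_k(B₃ε₁) ∩ 𝔅_k(V)», here as the HYPOTHESIS schema's two clauses + `minActionRegPr_le`). [cite: Balaban1985Variational, Thm 1 (8) p.279] -/
theorem isBackground_regPr_of_uminTriv_fieldShift (D : AlphaDataT3 F γ) {b₀ p₀ ε₀ : ℝ} (hU : UminTrivIsRegMinimiser D b₀ p₀ ε₀)
    {K n : ℕ} (h : n ≤ K) (V : GaugeField (F.P n) 0 (Matrix.specialUnitaryGroup (Fin 2) ℂ)) (hV : PlaqSmall (θBal F.L γ b₀ p₀ n) V) :
    IsBackground (fun i => BlockAveraging.blockAvg (P := F.P K) (j := i) ℰp) {U | RegPr F n K ε₀ U} (K - n)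
      (fieldShift (F.sitesPerDir_eq (m := F.m) (K := K) (j := K - n) (m' := F.m) (K' := n) (j' := 0) (by omega)) V)
      (D.Umin K (K - n) (D.triv K (K - n))
        (fieldShift (F.sitesPerDir_eq (m := F.m) (K := K) (j := K - n) (m' := F.m) (K' := n) (j' := 0) (by omega)) V)) := by
  obtain ⟨hmem, hmin⟩ := hU K n h V hV
  rw [mem_regFibrePr_iff] at hmem
  refine ⟨(mem_fibre_iff_iter_eq h _ V).mp hmem.1, hmem.2, fun U hUreg havg => ?_⟩
  rw [hmin]
  exact minActionRegPr_le F ((mem_regFibrePr_iff (F := F)).mpr ⟨(mem_fibre_iff_iter_eq h U V).mpr havg, hUreg⟩)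

/-- ★★ **THE SAME FOR A DATUM GIVEN ON RUN `K`'s LEVEL `K − n` DIRECTLY** (the (m2) door's variable): `W ↦ V := fieldShift⁻¹ W`. [cite: Balaban1985Variational, Thm 1 (8) p.279] -/
theorem isBackground_regPr_of_uminTriv (D : AlphaDataT3 F γ) {b₀ p₀ ε₀ : ℝ} (hU : UminTrivIsRegMinimiser D b₀ p₀ ε₀)
    {K n : ℕ} (h : n ≤ K) (W : GaugeField (F.P K) (K - n) (Matrix.specialUnitaryGroup (Fin 2) ℂ)) (hW : PlaqSmall (θBal F.L γ b₀ p₀ n) W) :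
    IsBackground (fun i => BlockAveraging.blockAvg (P := F.P K) (j := i) ℰp) {U | RegPr F n K ε₀ U} (K - n) W
      (D.Umin K (K - n) (D.triv K (K - n)) W) := by
  set e := F.sitesPerDir_eq (m := F.m) (K := K) (j := K - n) (m' := F.m) (K' := n) (j' := 0) (by omega) with he
  have hWV : fieldShift e (fieldShift e.symm W) = W := fieldShift_symm_fieldShift e W
  have hV : PlaqSmall (θBal F.L γ b₀ p₀ n) (fieldShift e.symm W) := fun p => by
    rw [plaqHol_fieldShift]; exact hW _
  have key := isBackground_regPr_of_uminTriv_fieldShift D hU h (fieldShift e.symm W) hV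
  rwa [hWV] at key

/-! ## §3 The two companion fields of the δ2-a `Witness` for the printed class -/

/-- **`reg_regular` FOR THE PRINTED CLASS**: print's regular space lies in the class file's regular window as soon as the schedule grants `regThreshold F n K ε₀ ≤ δreg`
(first clause of [Balaban1985Variational] (2) p.278 at the finest level). [cite: Balaban1985Variational, (2) p.278] -/
theorem regPr_subset_plaqSmall {n K : ℕ} {ε₀ δreg : ℝ} (hδ : regThreshold F n K ε₀ ≤ δreg) :
    {U : GaugeField (F.P K) 0 (Matrix.specialUnitaryGroup (Fin 2) ℂ) | RegPr F n K ε₀ U} ⊆ {U | PlaqSmall δreg U} :=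
  fun _ hU p => (hU.plaqSmall p).trans_le hδ

/-- **`one_mem_reg` FOR THE PRINTED CLASS**: the trivial configuration is printed-regular for `ε₀ > 0` (✓`regPr_one`). [cite: Balaban1985Variational, (2) p.278] -/
theorem one_mem_regPr {n K : ℕ} {ε₀ : ℝ} (hε : 0 < ε₀) :
    (1 : GaugeField (F.P K) 0 (Matrix.specialUnitaryGroup (Fin 2) ℂ)) ∈ {U : GaugeField (F.P K) 0 (Matrix.specialUnitaryGroup (Fin 2) ℂ) | RegPr F n K ε₀ U} :=
  regPr_one hε

/-- The same guarded by the class file's `0 < δreg` (the exact binder of `Witness.one_mem_reg`), for a schedule with `regThreshold ≤ δreg` and `0 < ε₀`.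
[cite: Balaban1985Variational, (2) p.278] -/
theorem one_mem_regPr_of_pos {n K : ℕ} {ε₀ δreg : ℝ} (hε : 0 < ε₀) (_hδ : 0 < δreg) :
    (1 : GaugeField (F.P K) 0 (Matrix.specialUnitaryGroup (Fin 2) ℂ)) ∈ {U : GaugeField (F.P K) 0 (Matrix.specialUnitaryGroup (Fin 2) ℂ) | RegPr F n K ε₀ U} :=
  one_mem_regPr hε

/-! ## §4 The (m2) door's `isBackground` binder, verbatim -/

/-- ★★ **THE δ2 ROW OF THE (m2) DOOR, IN THE WITNESS's BINDER SHAPE** (run `K`, height `n`, level `K − n`, any window `δ ≤ θBal(n)`): with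
`bg := fun W => D.Umin K (K − n) (D.triv K (K − n)) W` and `reg := {U | RegPr F n K ε₀ U}`,
`∀ W, PlaqSmall δ W → IsBackground (blockAvg ℰp) reg (K − n) W (bg W)` — character-for-character the `isBackground` field of a `BalabanUVClass.Witness` (v1.2, δ2-a) at
`k := K − n` for that class. [cite: Balaban1985Variational, Thm 1 (8) p.279] -/
theorem isBackground_regPr_window (D : AlphaDataT3 F γ) {b₀ p₀ ε₀ : ℝ} (hU : UminTrivIsRegMinimiser D b₀ p₀ ε₀) {K n : ℕ} (h : n ≤ K)
    {δ : ℝ} (hδ : δ ≤ θBal F.L γ b₀ p₀ n) :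
    ∀ W : GaugeField (F.P K) (K - n) (Matrix.specialUnitaryGroup (Fin 2) ℂ), PlaqSmall δ W →
      IsBackground (fun i => BlockAveraging.blockAvg (P := F.P K) (j := i) ℰp) {U | RegPr F n K ε₀ U} (K - n) W
        ((fun W => D.Umin K (K - n) (D.triv K (K - n)) W) W) :=
  fun W hW => isBackground_regPr_of_uminTriv D hU h W fun p => (hW p).trans_le hδ

/-- The three `IsBackground` clauses unpacked for consumers that do not open `Setup.IsBackground`: average, regularity (BOTH printed clauses), minimality over the
printed class. [cite: Balaban1985Variational, Thm 1 (8) p.279] -/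
theorem uminTriv_clauses (D : AlphaDataT3 F γ) {b₀ p₀ ε₀ : ℝ} (hU : UminTrivIsRegMinimiser D b₀ p₀ ε₀) {K n : ℕ} (h : n ≤ K)
    (W : GaugeField (F.P K) (K - n) (Matrix.specialUnitaryGroup (Fin 2) ℂ)) (hW : PlaqSmall (θBal F.L γ b₀ p₀ n) W) :
    Averaging.iter (fun i => BlockAveraging.blockAvg (P := F.P K) (j := i) ℰp) (K - n) (D.Umin K (K - n) (D.triv K (K - n)) W) = W ∧
      RegPr F n K ε₀ (D.Umin K (K - n) (D.triv K (K - n)) W) ∧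
      ∀ U : GaugeField (F.P K) 0 (Matrix.specialUnitaryGroup (Fin 2) ℂ), RegPr F n K ε₀ U →
        Averaging.iter (fun i => BlockAveraging.blockAvg (P := F.P K) (j := i) ℰp) (K - n) U = W →
          wilsonAction4 (D.Umin K (K - n) (D.triv K (K - n)) W) ≤ wilsonAction4 U :=
  isBackground_regPr_of_uminTriv D hU h W hW

end Summit.QuantumFields.YangMills.Theorems.FluctuationComparisonRegPrIntLS1aAlphaBackgroundClass

end
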